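import Summits.CriticalPhenomena.PercolationContinuityZ3.Theorems.PercNearOneGluingNoHeavyLowerTailSunflowerGrainCertificate

/-!
# `NoHeavyLowerTail` (crux stmt-CriticalPhenomena-4575), abstract sunflower cubic: THE GRAIN-MODEL CERTIFICATE INEQUALITY
# (memo FINDING-PAR-prove1-g46 THEOREM 2): `G(𝒰) ≤ F_𝒰[φ]` for every union-closed `𝒰`

Support file (seat `prim-ineq-prove-1` gen 46; `--supports stmt-CriticalPhenomena-4575`).  Continues `…SunflowerGrainCertificate`.
GRAIN MODEL.  Atoms `i : ι` with masses `m i ≥ 0`, `∑ m < 1`, grains `N i` (finite sets of coordinates); on a finite coordinate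
set `R` every coordinate `r` is present independently with probability `q r ∈ [0,1]` (outcome `W ⊆ R`, weight `wt q R W`).
Atom `i` is COVERED through the family `𝒰` if some `S ∈ 𝒰` with `i ∈ S` has all its grains present: `N j ∩ R ⊆ W` for all
`j ∈ S`.  `G m q N R 𝒰 = 1 - ∑_i m i · P(i covered)` and `φ_R i = m i · ∏_{r ∈ N i ∩ R} q r`.
* `G_insert` (conditioning on one coordinate): `G_{R ∪ r}(𝒰) = q_r · G_R(𝒰) + (1 - q_r) · G_R(𝒰⁰)`, `𝒰⁰ = {S ∈ 𝒰 : r ∉ N_S}`;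
* `G_empty_le` (the case `R = ∅`, from `Grain.one_sub_le_FR`);
* **`G_le_FR`** (THEOREM 2 of the memo): for union-closed `𝒰`, `G m q N R 𝒰 ≤ FR (phi m q N R) 𝒰` — by induction on `R`, the step
  being the chord inequality `Grain.FR_chord` (concavity from (PAR)).
The bipartite cost game (THEOREM 3, BAL-bip) is the special case "atoms = values of `N(ω ∩ L)`" (next file).
-/

namespace Summit.CriticalPhenomena.PercolationContinuityZ3.Theorems.SunflowerPartition

namespace Grain

open Finset

variable {ι : Type*} [Fintype ι] [DecidableEq ι] {ρ : Type*} [DecidableEq ρ]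

/-- Weight of the outcome `W ⊆ R`: `∏_{r∈W} q r · ∏_{r ∈ R∖W} (1 - q r)`. [this work] -/
noncomputable def wt (q : ρ → ℝ) (R W : Finset ρ) : ℝ := (∏ r ∈ W, q r) * ∏ r ∈ R \ W, (1 - q r)

open Classical in
/-- Coverage indicator of atom `i` through `𝒰` at outcome `W`. [this work] -/
noncomputable def cov (N : ι → Finset ρ) (R : Finset ρ) (𝒰 : Finset (Finset ι)) (i : ι) (W : Finset ρ) : ℝ :=
  if ∃ S ∈ 𝒰, i ∈ S ∧ ∀ j ∈ S, N j ∩ R ⊆ W then 1 else 0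

/-- Coverage probability of atom `i`. [this work] -/
noncomputable def hit (q : ρ → ℝ) (N : ι → Finset ρ) (R : Finset ρ) (𝒰 : Finset (Finset ι)) (i : ι) : ℝ :=
  ∑ W ∈ R.powerset, wt q R W * cov N R 𝒰 i W

/-- The grain game `G(𝒰) = 1 - ∑_i m_i P(i covered through 𝒰)`. [this work] -/
noncomputable def G (m : ι → ℝ) (q : ρ → ℝ) (N : ι → Finset ρ) (R : Finset ρ) (𝒰 : Finset (Finset ι)) : ℝ :=
  1 - ∑ i, m i * hit q N R 𝒰 i

/-- `φ_R i = m i · ∏_{r ∈ N i ∩ R} q r`. [this work] -/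
noncomputable def phi (m : ι → ℝ) (q : ρ → ℝ) (N : ι → Finset ρ) (R : Finset ρ) (i : ι) : ℝ :=
  m i * ∏ r ∈ N i ∩ R, q r

/-- The sub-family of members whose grains avoid the coordinate `r`. [this work] -/
def avoid (N : ι → Finset ρ) (r : ρ) (𝒰 : Finset (Finset ι)) : Finset (Finset ι) :=
  𝒰.filter fun S => ∀ j ∈ S, r ∉ N j

variable {m : ι → ℝ} {q : ρ → ℝ} {N : ι → Finset ρ}

/-! ## Conditioning on one coordinate -/

omit [Fintype ι] [DecidableEq ι] in
/-- `wt (insert r R₀) W = (1 - q r) · wt R₀ W` for `W ⊆ R₀ ∌ r`. [this work] -/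
theorem wt_insert_of_subset (R₀ W : Finset ρ) (r : ρ) (hr : r ∉ R₀) (hW : W ⊆ R₀) :
    wt q (insert r R₀) W = (1 - q r) * wt q R₀ W := by
  unfold wt
  have : insert r R₀ \ W = insert r (R₀ \ W) := by
    rw [insert_sdiff_of_notMem _ (fun h => hr (hW h))]
  rw [this, prod_insert (fun h => hr (mem_sdiff.mp h).1)]
  ring

omit [Fintype ι] [DecidableEq ι] in
/-- `wt (insert r R₀) (insert r W) = q r · wt R₀ W` for `W ⊆ R₀ ∌ r`. [this work] -/
theorem wt_insert_insert (R₀ W : Finset ρ) (r : ρ) (hr : r ∉ R₀) (hW : W ⊆ R₀) :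
    wt q (insert r R₀) (insert r W) = q r * wt q R₀ W := by
  unfold wt
  have hrW : r ∉ W := fun h => hr (hW h)
  have : insert r R₀ \ insert r W = R₀ \ W := by
    ext a; simp only [mem_sdiff, mem_insert]
    constructor
    · rintro ⟨h | h, hnb⟩
      · exact absurd (Or.inl h) hnb
      · exact ⟨h, fun hb => hnb (Or.inr hb)⟩
    · rintro ⟨h, hnb⟩
      exact ⟨Or.inr h, fun hb => hb.elim (fun hb => hr (hb ▸ h)) hnb⟩
  rw [this, prod_insert hrW]
  ring

/-- Coverage at `insert r W` on `insert r R₀` = coverage at `W` on `R₀`. [this work] -/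
theorem cov_insert_insert (R₀ W : Finset ρ) (r : ρ) (hr : r ∉ R₀) (𝒰 : Finset (Finset ι)) (i : ι) :
    cov N (insert r R₀) 𝒰 i (insert r W) = cov N R₀ 𝒰 i W := by
  unfold cov
  have key : ∀ j, N j ∩ insert r R₀ ⊆ insert r W ↔ N j ∩ R₀ ⊆ W := by
    intro j
    constructor
    · intro h a ha
      have ha' : a ∈ N j ∩ insert r R₀ := by
        rw [mem_inter] at ha ⊢; exact ⟨ha.1, mem_insert_of_mem ha.2⟩
      rcases mem_insert.mp (h ha') with h1 | h1
      · exact absurd (mem_inter.mp ha).2 (h1 ▸ hr)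
      · exact h1
    · intro h a ha
      rw [mem_inter, mem_insert] at ha
      rcases ha.2 with h1 | h1
      · exact h1 ▸ mem_insert_self r W
      · exact mem_insert_of_mem (h (mem_inter.mpr ⟨ha.1, h1⟩))
  simp only [key]

/-- Coverage at `W ⊆ R₀` on `insert r R₀` = coverage through the `r`-avoiding sub-family on `R₀`. [this work] -/
theorem cov_insert_of_subset (R₀ W : Finset ρ) (r : ρ) (hr : r ∉ R₀) (hW : W ⊆ R₀) (𝒰 : Finset (Finset ι)) (i : ι) :
    cov N (insert r R₀) 𝒰 i W = cov N R₀ (avoid N r 𝒰) i W := by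
  unfold cov avoid
  have hrW : r ∉ W := fun h => hr (hW h)
  have key : (∃ S ∈ 𝒰, i ∈ S ∧ ∀ j ∈ S, N j ∩ insert r R₀ ⊆ W) ↔
      ∃ S ∈ 𝒰.filter (fun S => ∀ j ∈ S, r ∉ N j), i ∈ S ∧ ∀ j ∈ S, N j ∩ R₀ ⊆ W := by
    constructor
    · rintro ⟨S, hS, hiS, hN⟩
      have hrN : ∀ j ∈ S, r ∉ N j := fun j hj hrj =>
        hrW (hN j hj (mem_inter.mpr ⟨hrj, mem_insert_self r R₀⟩))
      refine ⟨S, mem_filter.mpr ⟨hS, hrN⟩, hiS, fun j hj a ha => hN j hj ?_⟩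
      rw [mem_inter] at ha ⊢; exact ⟨ha.1, mem_insert_of_mem ha.2⟩
    · rintro ⟨S, hS, hiS, hN⟩
      obtain ⟨hS𝒰, hrN⟩ := mem_filter.mp hS
      refine ⟨S, hS𝒰, hiS, fun j hj a ha => ?_⟩
      rw [mem_inter, mem_insert] at ha
      rcases ha.2 with h1 | h1
      · exact absurd (h1 ▸ ha.1) (hrN j hj)
      · exact hN j hj (mem_inter.mpr ⟨ha.1, h1⟩)
  simp only [key]

/-- `hit` conditioned on the coordinate `r`. [this work] -/
theorem hit_insert (R₀ : Finset ρ) (r : ρ) (hr : r ∉ R₀) (𝒰 : Finset (Finset ι)) (i : ι) :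
    hit q N (insert r R₀) 𝒰 i = q r * hit q N R₀ 𝒰 i + (1 - q r) * hit q N R₀ (avoid N r 𝒰) i := by
  unfold hit
  rw [sum_powerset_insert hr]
  have h1 : ∑ W ∈ R₀.powerset, wt q (insert r R₀) W * cov N (insert r R₀) 𝒰 i W =
      (1 - q r) * ∑ W ∈ R₀.powerset, wt q R₀ W * cov N R₀ (avoid N r 𝒰) i W := by
    rw [mul_sum]
    refine sum_congr rfl fun W hW => ?_
    have hW' : W ⊆ R₀ := mem_powerset.mp hW
    rw [wt_insert_of_subset R₀ W r hr hW', cov_insert_of_subset R₀ W r hr hW']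
    ring
  have h2 : ∑ W ∈ R₀.powerset, wt q (insert r R₀) (insert r W) * cov N (insert r R₀) 𝒰 i (insert r W) =
      q r * ∑ W ∈ R₀.powerset, wt q R₀ W * cov N R₀ 𝒰 i W := by
    rw [mul_sum]
    refine sum_congr rfl fun W hW => ?_
    have hW' : W ⊆ R₀ := mem_powerset.mp hW
    rw [wt_insert_insert R₀ W r hr hW', cov_insert_insert R₀ W r hr]
    ring
  rw [h1, h2]
  ring

/-- **Conditioning identity**: `G_{R ∪ r}(𝒰) = q_r G_R(𝒰) + (1 - q_r) G_R(𝒰⁰)`. [this work] -/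
theorem G_insert (R₀ : Finset ρ) (r : ρ) (hr : r ∉ R₀) (𝒰 : Finset (Finset ι)) :
    G m q N (insert r R₀) 𝒰 = q r * G m q N R₀ 𝒰 + (1 - q r) * G m q N R₀ (avoid N r 𝒰) := by
  unfold G
  simp_rw [hit_insert R₀ r hr]
  rw [mul_sub, mul_sub, mul_sum, mul_sum]
  have : ∑ i, m i * (q r * hit q N R₀ 𝒰 i + (1 - q r) * hit q N R₀ (avoid N r 𝒰) i) =
      ∑ i, q r * (m i * hit q N R₀ 𝒰 i) + ∑ i, (1 - q r) * (m i * hit q N R₀ (avoid N r 𝒰) i) := by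
    rw [← sum_add_distrib]; exact sum_congr rfl fun i _ => by ring
  rw [this]; ring

/-! ## The case `R = ∅` -/

/-- On `R = ∅` the game is `1 - m(⋃𝒰)` and `φ = m`. [this work] -/
theorem G_empty_le (hm0 : ∀ i, 0 ≤ m i) (hm1 : ∑ i, m i < 1) (𝒰 : Finset (Finset ι)) :
    G m q N ∅ 𝒰 ≤ FR (phi m q N ∅) 𝒰 := by
  classical
  have hphi : phi m q N ∅ = m := by
    funext i; simp [phi]
  rw [hphi]
  set W : Finset ι := univ.filter fun i => ∃ S ∈ 𝒰, i ∈ S with hW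
  have hG : G m q N ∅ 𝒰 = 1 - ∑ i ∈ W, m i := by
    unfold G hit
    rw [powerset_empty, hW, sum_filter]
    congr 1
    refine sum_congr rfl fun i _ => ?_
    rw [sum_singleton]
    unfold wt cov
    simp only [empty_sdiff, prod_empty, mul_one, one_mul, inter_empty, empty_subset, imp_true_iff, and_true]
    split_ifs <;> simp
  rw [hG]
  exact one_sub_le_FR hm0 hm1 𝒰 W fun S hS i hi => mem_filter.mpr ⟨mem_univ i, S, hS, hi⟩

/-! ## THEOREM 2: the grain-model certificate inequality -/

omit [Fintype ι] [DecidableEq ι] in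
/-- `φ_R ≥ 0`. [this work] -/
theorem phi_nonneg (hm0 : ∀ i, 0 ≤ m i) (hq0 : ∀ r, 0 ≤ q r) (R : Finset ρ) (i : ι) : 0 ≤ phi m q N R i :=
  mul_nonneg (hm0 i) (prod_nonneg fun r _ => hq0 r)

omit [DecidableEq ι] in
/-- `∑ φ_R < 1`. [this work] -/
theorem sum_phi_lt_one (hm0 : ∀ i, 0 ≤ m i) (hm1 : ∑ i, m i < 1) (hq0 : ∀ r, 0 ≤ q r) (hq1 : ∀ r, q r ≤ 1)
    (R : Finset ρ) : ∑ i, phi m q N R i < 1 :=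
  lt_of_le_of_lt (sum_le_sum fun i _ => by
    unfold phi
    exact mul_le_of_le_one_right (hm0 i) (prod_le_one (fun r _ => hq0 r) fun r _ => hq1 r)) hm1

/-- `φ_{R ∪ r} = (φ_R)^{K, q_r}` with `K = {j : r ∈ N j}`. [this work] -/
theorem phi_insert (R₀ : Finset ρ) (r : ρ) (hr : r ∉ R₀) :
    phi m q N (insert r R₀) = scale (univ.filter fun j => r ∈ N j) (q r) (phi m q N R₀) := by
  funext i
  unfold phi scale
  by_cases h : r ∈ N i
  · have : N i ∩ insert r R₀ = insert r (N i ∩ R₀) := by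
      rw [inter_insert_of_mem h]
    rw [this, prod_insert (fun h' => hr (mem_inter.mp h').2), if_pos (mem_filter.mpr ⟨mem_univ i, h⟩)]
    ring
  · rw [inter_insert_of_notMem h, if_neg (show i ∉ univ.filter (fun j => r ∈ N j) from
      fun h' => h (mem_filter.mp h').2)]

/-- The `r`-avoiding sub-family of a union-closed family is union-closed. [this work] -/
theorem avoid_union_closed (r : ρ) (𝒰 : Finset (Finset ι)) (h𝒰 : ∀ S ∈ 𝒰, ∀ S' ∈ 𝒰, S ∪ S' ∈ 𝒰) :
    ∀ S ∈ avoid N r 𝒰, ∀ S' ∈ avoid N r 𝒰, S ∪ S' ∈ avoid N r 𝒰 := by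
  classical
  intro S hS S' hS'
  obtain ⟨hS1, hS2⟩ := mem_filter.mp hS
  obtain ⟨hS1', hS2'⟩ := mem_filter.mp hS'
  refine mem_filter.mpr ⟨h𝒰 S hS1 S' hS1', fun j hj => ?_⟩
  rcases mem_union.mp hj with h | h
  · exact hS2 j h
  · exact hS2' j h

/-- `𝒰⁰` is the sub-family of members missing `K = {j : r ∈ N j}`. [this work] -/
theorem avoid_eq_filter (r : ρ) (𝒰 : Finset (Finset ι)) :
    avoid N r 𝒰 = 𝒰.filter fun S => ∀ j ∈ S, j ∉ (univ.filter fun j => r ∈ N j) := by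
  unfold avoid
  refine filter_congr fun S _ => ?_
  simp only [mem_filter, mem_univ, true_and]

/-- **THEOREM 2 (grain-model certificate inequality).**  For masses `m ≥ 0` with `∑ m < 1`, probabilities `q ∈ [0,1]`,
arbitrary grains `N`, every finite coordinate set `R` and every UNION-CLOSED family `𝒰`:
    `G m q N R 𝒰 ≤ FR (phi m q N R) 𝒰 = ∏_{S ∈ 𝒰} t_S[φ_R]`.
Induction on `R`: `R = ∅` is `one_sub_le_FR`; the step conditions on one coordinate (`G_insert`) and closes with the chord
inequality `FR_chord` (concavity of `q ↦ F_𝒰[ψ^{K,q}]`, from (PAR)). [this work] -/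
theorem G_le_FR (hm0 : ∀ i, 0 ≤ m i) (hm1 : ∑ i, m i < 1) (hq0 : ∀ r, 0 ≤ q r) (hq1 : ∀ r, q r ≤ 1) (R : Finset ρ) :
    ∀ 𝒰 : Finset (Finset ι), (∀ S ∈ 𝒰, ∀ S' ∈ 𝒰, S ∪ S' ∈ 𝒰) → G m q N R 𝒰 ≤ FR (phi m q N R) 𝒰 := by
  induction R using Finset.induction_on with
  | empty => intro 𝒰 _; exact G_empty_le hm0 hm1 𝒰
  | insert r R₀ hr ih =>
    intro 𝒰 h𝒰
    rw [G_insert R₀ r hr 𝒰, phi_insert R₀ r hr]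
    set ψ := phi m q N R₀ with hψ
    set K : Finset ι := univ.filter fun j => r ∈ N j with hK
    have hψ0 : ∀ i, 0 ≤ ψ i := phi_nonneg hm0 hq0 R₀
    have hψ1 : ∑ i, ψ i < 1 := sum_phi_lt_one hm0 hm1 hq0 hq1 R₀
    have h1 := ih 𝒰 h𝒰
    have h0 := ih (avoid N r 𝒰) (avoid_union_closed r 𝒰 h𝒰)
    have hqr0 := hq0 r
    have hqr1 : 0 ≤ 1 - q r := by linarith [hq1 r]
    calc q r * G m q N R₀ 𝒰 + (1 - q r) * G m q N R₀ (avoid N r 𝒰)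
        ≤ q r * FR ψ 𝒰 + (1 - q r) * FR ψ (avoid N r 𝒰) := by
          gcongr
      _ = q r * FR ψ 𝒰 + (1 - q r) * FR (scale K 0 ψ) 𝒰 := by
          rw [FR_scale_zero K hψ0 hψ1 𝒰, avoid_eq_filter r 𝒰]
      _ ≤ FR (scale K (q r) ψ) 𝒰 := FR_chord 𝒰 h𝒰 hψ0 hψ1 K (hq0 r) (hq1 r)

/-! ## Arbitrary families: reduction to the union-closure -/

/-- The union-closure of a finite family: all unions of nonempty sub-families. [this work] -/
def uclos (𝒰 : Finset (Finset ι)) : Finset (Finset ι) := (𝒰.powerset.erase ∅).image fun 𝒮 => 𝒮.sup id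

omit [Fintype ι] in
/-- Membership in the union-closure. [this work] -/
theorem mem_uclos {𝒰 : Finset (Finset ι)} {S : Finset ι} :
    S ∈ uclos 𝒰 ↔ ∃ 𝒮 ⊆ 𝒰, 𝒮.Nonempty ∧ 𝒮.sup id = S := by
  unfold uclos
  simp only [mem_image, mem_erase, mem_powerset, ne_eq]
  constructor
  · rintro ⟨𝒮, ⟨hne, hsub⟩, rfl⟩; exact ⟨𝒮, hsub, nonempty_iff_ne_empty.mpr hne, rfl⟩
  · rintro ⟨𝒮, hsub, hne, rfl⟩; exact ⟨𝒮, ⟨nonempty_iff_ne_empty.mp hne, hsub⟩, rfl⟩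

omit [Fintype ι] in
/-- `𝒰 ⊆ uclos 𝒰`. [this work] -/
theorem subset_uclos (𝒰 : Finset (Finset ι)) : 𝒰 ⊆ uclos 𝒰 := fun S hS =>
  mem_uclos.mpr ⟨{S}, singleton_subset_iff.mpr hS, singleton_nonempty S, by simp⟩

omit [Fintype ι] in
/-- The union-closure is union-closed. [this work] -/
theorem uclos_union_closed (𝒰 : Finset (Finset ι)) :
    ∀ S ∈ uclos 𝒰, ∀ S' ∈ uclos 𝒰, S ∪ S' ∈ uclos 𝒰 := by
  intro S hS S' hS'
  obtain ⟨𝒮, h𝒮, hne, rfl⟩ := mem_uclos.mp hS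
  obtain ⟨𝒮', h𝒮', -, rfl⟩ := mem_uclos.mp hS'
  refine mem_uclos.mpr ⟨𝒮 ∪ 𝒮', union_subset h𝒮 h𝒮', hne.mono subset_union_left, ?_⟩
  rw [sup_union]; rfl

/-- Coverage is invariant under union-closure of the family. [this work] -/
theorem cov_uclos (R : Finset ρ) (𝒰 : Finset (Finset ι)) (i : ι) (W : Finset ρ) :
    cov N R (uclos 𝒰) i W = cov N R 𝒰 i W := by
  unfold cov
  have key : (∃ S ∈ uclos 𝒰, i ∈ S ∧ ∀ j ∈ S, N j ∩ R ⊆ W) ↔ ∃ S ∈ 𝒰, i ∈ S ∧ ∀ j ∈ S, N j ∩ R ⊆ W := by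
    constructor
    · rintro ⟨S, hS, hiS, hN⟩
      obtain ⟨𝒮, h𝒮, -, rfl⟩ := mem_uclos.mp hS
      obtain ⟨S₀, hS₀, hiS₀⟩ := mem_sup.mp hiS
      exact ⟨S₀, h𝒮 hS₀, hiS₀, fun j hj => hN j (mem_sup.mpr ⟨S₀, hS₀, hj⟩)⟩
    · rintro ⟨S, hS, hiS, hN⟩
      exact ⟨S, subset_uclos 𝒰 hS, hiS, hN⟩
  simp only [key]

/-- The game is invariant under union-closure of the family. [this work] -/
theorem G_uclos (R : Finset ρ) (𝒰 : Finset (Finset ι)) : G m q N R (uclos 𝒰) = G m q N R 𝒰 := by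
  unfold G hit
  simp_rw [cov_uclos]

/-- `F_{uclos 𝒰} ≤ F_𝒰` (the extra factors lie in `(0,1]`). [this work] -/
theorem FR_uclos_le {φ : ι → ℝ} (hφ : ∀ i, 0 ≤ φ i) (h1 : ∑ i, φ i < 1) (𝒰 : Finset (Finset ι)) :
    FR φ (uclos 𝒰) ≤ FR φ 𝒰 := by
  unfold FR
  rw [← prod_sdiff (subset_uclos 𝒰)]
  calc (∏ S ∈ uclos 𝒰 \ 𝒰, tR φ S) * ∏ S ∈ 𝒰, tR φ S ≤ 1 * ∏ S ∈ 𝒰, tR φ S :=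
        mul_le_mul_of_nonneg_right (FR_le_one hφ h1 _) (FR_pos hφ h1 𝒰).le
    _ = ∏ S ∈ 𝒰, tR φ S := one_mul _

/-- **THEOREM 2 for ARBITRARY families**: `G m q N R 𝒰 ≤ ∏_{S ∈ 𝒰} t_S[φ_R]`. [this work] -/
theorem G_le_FR' (hm0 : ∀ i, 0 ≤ m i) (hm1 : ∑ i, m i < 1) (hq0 : ∀ r, 0 ≤ q r) (hq1 : ∀ r, q r ≤ 1) (R : Finset ρ)
    (𝒰 : Finset (Finset ι)) : G m q N R 𝒰 ≤ FR (phi m q N R) 𝒰 := by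
  rw [← G_uclos R 𝒰]
  exact (G_le_FR hm0 hm1 hq0 hq1 R (uclos 𝒰) (uclos_union_closed 𝒰)).trans
    (FR_uclos_le (phi_nonneg hm0 hq0 R) (sum_phi_lt_one hm0 hm1 hq0 hq1 R) 𝒰)

end Grain

end Summit.CriticalPhenomena.PercolationContinuityZ3.Theorems.SunflowerPartition
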